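import Literature.NumberTheory.LFunctions.Zhang2022.Section10Lemma102Estimate0
import Literature.NumberTheory.LFunctions.Zhang2022.Section8Lemma84
import Literature.NumberTheory.LFunctions.Zhang2022.Section10Lemma102Steps
import HarnessLib

/-!
# Zhang (2022), Lemma 10.2 — LEMMA A: the shift-0 log-mean of `χ(n)ξ₀ⱼ(n;d,r)n⁻¹` in the relative
# form, from Lemma 8.3 in the relative form

Topic `Literature/NumberTheory/LFunctions/Zhang2022` (Landau–Siegel audit tree; verdict-neutral).
Y. Zhang, *Discrete mean estimates and the Landau–Siegel zero*, arXiv:2211.02515v1 (2022)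
[Zhang2022LandauSiegel] — **an unrefereed manuscript under adjudication**; DAG nodes `Z22:Lem10.2.pf`,
`Z22:§10.u019/u021/u022` [Z22 p.56, tex L2824–L2851], campaign rows G-d43-1 (clauses (10.8)–(10.10)
of Lemma 10.2 carry the relative factor), G-adj1-1 / G-d55-3 (same root for Lemma 8.4). ZHANG-L
discharge lane (WP10, leaf `h102`).

Main result (`logMeanRel_of_lemma83Rel`): **`Skeleton.Lemma83Rel c′ →` LEMMA A**, where LEMMA A is
the `β_μ = 0` twin of the banked relative Lemma 8.4, VERBATIM the hypothesis `hA` of sz-d43's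
`Lemma102.eq108Rel_of_logMean` / `eq109Rel_of_logMean` / `eq1010Rel_of_logMean`
(`Section10Lemma102Steps`): for `D` large, (A), `1 ≤ j ≤ 3`, `d, r ≥ 1`, `dr < PT⁻²`, `T ≤ x ≤ P`,
`‖Σ_{n≤x} χ(n)ξ₀ⱼ(n;d,r)n⁻¹log(x/n) − L′(1,χ)Π(d,r)(1 + (β_{j+1}+β_{j+2})log x + ½β_{j+1}β_{j+2}log²x)‖
  ≤ C𝓛⁻⁶(∏_{q∣dr}(1−q⁻¹)⁻¹)²`.
The proof is sz-d27's assembly `Lemma84.lemma84Rel_of_lemma83Rel` with the shift-0 core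
`Lemma102.logMean_core` (files `Section10Lemma102SmallRect0/ContourBound0/Estimate0`, sz-d43's
`Section10Lemma102Model/Poles`) in place of `Lemma84.lemma84_core`: Perron (8.9), Landau's contour
`Re s = α` / `Re s = −c/(8𝓛)` truncated at height `D`, the exceptional zero of Lemma 5.5 with MV's
`1/L` bound (`Lemma84.exceptional_package`), Lemma 5.7 (`L′(1,χ) ≫ 1`), Lemma 5.8 on the small
rectangle, the residue at the triple pole, and the bookkeeping `Lemma84.rhs_le` (identical four-piece
right-hand side). Corollaries: the three clauses (10.8)–(10.10) of `Skeleton.Lemma102Rel c′` from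
`Lemma83Rel c′` (`eq108Rel_of_lemma83Rel`, `eq109Rel_of_lemma83Rel`, `eq1010Rel_of_lemma83Rel`).

No statement of the manuscript is assumed beyond the hypothesis `Lemma83Rel c′` (itself reduced to
the two Appendix-A leaves `Typed.AppendixA1.StepA_u007_analytic/read` by `Lemma83.lemma83Rel_of_parts`).
Nothing about the manuscript's Theorems 1–2 or about Landau–Siegel zeros is asserted.

## References

* Y. Zhang, arXiv:2211.02515v1 (2022), §10 Lemma 10.2 and its proof; §8 Lemmas 8.3–8.4, (8.9);
  §5 Lemmas 5.5, 5.7, 5.8. [cite: Zhang2022LandauSiegel, §10 Lemma 10.2]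
* H. L. Montgomery, R. C. Vaughan, *Multiplicative Number Theory I*, CUP 2007, §6.2, Thm 11.4.
  [cite: MontgomeryVaughan2007, Thm 11.4]
-/

noncomputable section

open Complex Real Finset

namespace Literature.NumberTheory.LFunctions.Zhang2022.Lemma102

open Skeleton

/-! ### LEMMA A from Lemma 8.3 (relative form) -/

/-- A threshold `D₁` beyond which `log D ≥ M`. [folklore] -/
private theorem exists_nat_le_log' (M : ℝ) : ∃ D₀ : ℕ, ∀ D : ℕ, D₀ ≤ D → M ≤ Real.log D := by
  refine ⟨⌈Real.exp M⌉₊ + 1, fun D hD => ?_⟩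
  have h1 : Real.exp M ≤ D := by
    have : (⌈Real.exp M⌉₊ : ℝ) + 1 ≤ D := by exact_mod_cast hD
    linarith [Nat.le_ceil (Real.exp M)]
  have hD0 : (0 : ℝ) < D := lt_of_lt_of_le (Real.exp_pos M) h1
  rw [Real.le_log_iff_exp_le hD0]
  exact h1

set_option maxHeartbeats 800000 in
/-- **LEMMA A (the shift-0 log-mean, relative form) follows from Lemma 8.3 (relative form).** For
every `c′`: if `Skeleton.Lemma83Rel c′` holds then there is an absolute `C` such that for `D` large,
under (A), for `1 ≤ j ≤ 3`, `d, r ≥ 1` with `dr < PT⁻²` and `T ≤ x ≤ P`,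
`‖Σ_{n≤x} χ(n)ξ₀ⱼ(n;d,r)n⁻¹log(x/n) − L′(1,χ)Π(d,r)(1 + (β_{j+1}+β_{j+2})log x + ½β_{j+1}β_{j+2}log²x)‖
  ≤ C𝓛⁻⁶(∏_{q∣dr}(1−q⁻¹)⁻¹)²` — Zhang's proof of Lemma 10.2 ("in view of (8.9) … the contour of
integration is moved in the same way as the proof of Lemma 8.1 … by Lemma 5.8") carried out in the
kernel against an arbitrary continuation `𝔲_j(d,r;·)` with the three properties of Lemma 8.3, the
relative factor coming from `|Π(d,r)| ≤ Π̂²` on the small-rectangle term and `𝔲 − Π = O(𝓛⁻⁸Π̂)`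
(rows G-d43-1, G-adj1-1). [cite: Zhang2022LandauSiegel, §10 Lemma 10.2]
[cite: MontgomeryVaughan2007, §6.2, Thm 11.4] -/
theorem logMeanRel_of_lemma83Rel {c' : ℝ} (h83 : Lemma83Rel c') :
    ∃ C : ℝ, ForAllLarge fun D _ χ => AssumptionA D χ → ∀ j ∈ ({1, 2, 3} : Finset ℕ), ∀ d r : ℕ,
      1 ≤ d → 1 ≤ r → ((d * r : ℕ) : ℝ) < bigP D / bigT D ^ 2 → ∀ x : ℝ, bigT D ≤ x → x ≤ bigP D →
        ‖(∑ n ∈ Finset.Ioc 0 ⌊x⌋₊, χ (n : ZMod D) * xiZero c' D j n d r / (n : ℂ) *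
              (Real.log (x / n) : ℂ)) -
            deriv χ.LFunction 1 * PiW χ d r *
              (1 + (betaJ c' D (j + 1) + betaJ c' D (j + 2)) * (Real.log x : ℂ) +
                betaJ c' D (j + 1) * betaJ c' D (j + 2) * (Real.log x : ℂ) ^ 2 / 2)‖ ≤
          C * (ell D ^ 6)⁻¹ * (∏ q ∈ (d * r).primeFactors, (1 - (q : ℝ)⁻¹)⁻¹) ^ 2 := by
  obtain ⟨C₈₃, D83, h83⟩ := h83
  obtain ⟨c, hc, hc4, Cinv, hCinv, K, hK, D₁, hpack⟩ := Lemma84.exceptional_package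
  obtain ⟨L₅₇, h57⟩ := Lemma57.lemma_5_7
  -- constants
  set C : ℝ := |C₈₃| with hCdef
  have hC0 : 0 ≤ C := abs_nonneg _
  set K₈ : ℝ := 7 + 15 * |c'| with hK₈
  have hK₈1 : 1 ≤ K₈ := by rw [hK₈]; linarith [abs_nonneg c']
  set C₅ : ℝ := 1 + 16 * Real.exp (9 / 2) * π ^ 2 * K₈ ^ 2 with hC₅
  set ℓ₀ : ℝ := Real.exp (-1) / 4 with hℓ₀
  have hℓ₀0 : 0 < ℓ₀ := by positivity
  set m : ℕ := ⌈2 * C⌉₊ with hm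
  set A₁ : ℝ := C * (Real.exp (8 * C + 4 * C * ((Nat.factorial 9 : ℝ) / 2 ^ 9)) * 2 ^ m) with hA₁
  have hA₁0 : 0 ≤ A₁ := by positivity
  set Cfin : ℝ := 1 / (2 * π) * (2 * Real.exp π * A₁ * (m + 33).factorial +
      40800 * π * A₁ * Cinv / c ^ 2 * ((10 * (m + 11)).factorial / (c / 8) ^ (10 * (m + 11))) +
      1800 * Real.exp π * A₁ * Cinv * ((m + 9).factorial / 2 ^ (m + 9)) +
      56 * Real.exp π * (C₅ * (24 * K₈ ^ 2 + 2 * K₈) / π + 128 * K₈ ^ 3 * C * Real.exp (9 / 2)))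
    with hCfin
  -- the threshold
  set Lmax : ℝ := max (max (max 3 L₅₇) (max (8 * π / c) (16 * K / c)))
    (max (max (K + 1) (K₈ * π)) (4 * C₅ / (ℓ₀ * π))) with hLmax
  obtain ⟨D₂, hD₂⟩ := exists_nat_le_log' Lmax
  refine ⟨Cfin, max (max D83 D₁) D₂, fun D _ χ hD hq hp hA j hj d r hd hr hdr x hx1 hx2 => ?_⟩
  have hD83 : D83 ≤ D := le_trans (le_trans (le_max_left _ _) (le_max_left _ _)) hD
  have hD₁ : D₁ ≤ D := le_trans (le_trans (le_max_right _ _) (le_max_left _ _)) hD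
  have hLm : Lmax ≤ Real.log D := hD₂ D (le_trans (le_max_right _ _) hD)
  set 𝓛 : ℝ := Real.log D with h𝓛def
  have h𝓛3 : 3 ≤ 𝓛 := le_trans (by simp [hLmax]) hLm
  have hL57 : L₅₇ ≤ 𝓛 := le_trans (by simp [hLmax]) hLm
  have hL8πc : 8 * π / c ≤ 𝓛 := le_trans (by simp [hLmax]) hLm
  have hL16K : 16 * K / c ≤ 𝓛 := le_trans (by simp [hLmax]) hLm
  have hLK1 : K + 1 ≤ 𝓛 := le_trans (by simp [hLmax]) hLm
  have hLK₈ : K₈ * π ≤ 𝓛 := le_trans (by simp [hLmax]) hLm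
  have hLC₅ : 4 * C₅ / (ℓ₀ * π) ≤ 𝓛 := le_trans (by simp [hLmax]) hLm
  have h𝓛0 : 0 < 𝓛 := by linarith
  have h𝓛1 : 1 ≤ 𝓛 := by linarith
  have hℓ : ell D = 𝓛 := rfl
  have hπ0 := Real.pi_pos
  have hπ3 := Real.pi_gt_three
  -- `D` itself
  have hD0 : (0 : ℝ) < D := by
    rcases lt_or_ge 0 (D : ℝ) with h | h
    · exact h
    · have : Real.log (D : ℝ) ≤ 0 := by
        have : (D : ℝ) = 0 := le_antisymm h (Nat.cast_nonneg D)
        rw [this, Real.log_zero]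
      linarith
  have hDexp : (D : ℝ) = Real.exp 𝓛 := by rw [h𝓛def, Real.exp_log hD0]
  have hD3 : (3 : ℝ) ≤ D := by
    have : Real.exp 3 ≤ Real.exp 𝓛 := Real.exp_le_exp.2 h𝓛3
    have h3 : (3 : ℝ) ≤ Real.exp 3 := by have := Real.add_one_le_exp (3 : ℝ); linarith
    linarith
  have hD2 : 2 ≤ D := by exact_mod_cast (show (2 : ℝ) ≤ D by linarith)
  have hχ1 : χ ≠ 1 := Lemma31.ne_one_of_isPrimitive χ hD2 hp
  have hA' : ‖χ.LFunction 1‖ ≤ 1 / Real.log D ^ 2022 := le_of_lt hA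
  have hA'' : ‖χ.LFunction 1‖ < (Real.log D ^ 2022)⁻¹ := by rw [← one_div]; exact hA
  -- parameters
  set α : ℝ := alpha D with hαdef
  have hαeq : α = π / 𝓛 ^ 9 := Lemma84.alpha_eq D
  have hα0 : 0 < α := by rw [hαeq]; positivity
  set η : ℝ := c / (8 * 𝓛) with hηdef
  have hη0 : 0 < η := by positivity
  have hη' : η ≤ 1 / 96 := by
    calc η = c / (8 * 𝓛) := hηdef
      _ ≤ (1 / 4) / (8 * 3) := by gcongr
      _ = 1 / 96 := by norm_num
  have hαη : α ≤ η := by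
    -- `π/𝓛⁹ ≤ c/(8𝓛)` since `8π/c ≤ 𝓛 ≤ 𝓛⁸`
    rw [hαeq, hηdef, div_le_div_iff₀ (by positivity) (by positivity)]
    have h8 : 𝓛 ≤ 𝓛 ^ 8 := le_self_pow₀ h𝓛1 (by norm_num)
    have h1 : 8 * π ≤ c * 𝓛 := by rw [div_le_iff₀ hc] at hL8πc; linarith
    calc π * (8 * 𝓛) = (8 * π) * 𝓛 := by ring
      _ ≤ (c * 𝓛) * 𝓛 ^ 8 := by gcongr
      _ = c * 𝓛 ^ 9 := by ring
  have hη40 : η ≤ 1 / 40 := by linarith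
  -- the exceptional zero and the zero-free package
  obtain ⟨ρ, hρ1, hρK, hLρ, hL'ρ, hzfp⟩ := hpack D χ hD₁ hχ1 hA''
  have hKρ : 1 - ρ ≤ K / 𝓛 ^ 2 := by
    refine hρK.trans ?_
    rw [← div_eq_mul_inv]
    exact div_le_div_of_nonneg_left hK.le (by positivity) (pow_le_pow_right₀ h𝓛1 (by norm_num))
  have hρη : 1 - η / 2 ≤ ρ := by
    -- `K/𝓛² ≤ c/(16𝓛)` since `16K/c ≤ 𝓛`
    have h1 : K / 𝓛 ^ 2 ≤ c / (16 * 𝓛) := by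
      rw [div_le_div_iff₀ (by positivity) (by positivity)]
      have h16 : 16 * K ≤ c * 𝓛 := by rw [div_le_iff₀ hc] at hL16K; linarith
      calc K * (16 * 𝓛) = (16 * K) * 𝓛 := by ring
        _ ≤ (c * 𝓛) * 𝓛 := by gcongr
        _ = c * 𝓛 ^ 2 := by ring
    rw [hηdef]
    have : c / (8 * 𝓛) / 2 = c / (16 * 𝓛) := by ring
    linarith
  have hρα : 1 - α / 2 < ρ := by
    -- `1 − ρ ≤ K𝓛⁻²⁰²² ≤ K/𝓛¹⁰ < π/(2𝓛⁹)` since `K + 1 ≤ 𝓛`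
    have h1 : 1 - ρ ≤ K / 𝓛 ^ 10 := by
      refine hρK.trans ?_
      rw [← div_eq_mul_inv]
      exact div_le_div_of_nonneg_left hK.le (by positivity) (pow_le_pow_right₀ h𝓛1 (by norm_num))
    have h2 : K / 𝓛 ^ 10 < π / 𝓛 ^ 9 / 2 := by
      rw [div_div, div_lt_div_iff₀ (by positivity) (by positivity)]
      have h3 : K * 2 < π * 𝓛 := by
        calc K * 2 < 3 * (K + 1) := by linarith
          _ ≤ π * 𝓛 := mul_le_mul hπ3.le hLK1 (by linarith) (by linarith)
      calc K * (𝓛 ^ 9 * 2) = (K * 2) * 𝓛 ^ 9 := by ring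
        _ < (π * 𝓛) * 𝓛 ^ 9 := by gcongr
        _ = π * 𝓛 ^ 10 := by ring
    rw [hαeq]; linarith
  -- the `1/L` package on `Re s ≥ 1 − 2η`, `|Im s| ≤ D + 1`
  have hlog5 : Real.log ((D : ℝ) + 5) ≤ 2 * 𝓛 := by
    have h1 : (D : ℝ) + 5 ≤ (D : ℝ) ^ 2 := by
      have h0 : (0 : ℝ) ≤ ((D : ℝ) - 3) * ((D : ℝ) + 2) := mul_nonneg (by linarith) (by linarith)
      have e : ((D : ℝ) - 3) * ((D : ℝ) + 2) = (D : ℝ) ^ 2 - (D : ℝ) - 6 := by ring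
      rw [e] at h0; linarith
    calc Real.log ((D : ℝ) + 5) ≤ Real.log ((D : ℝ) ^ 2) := Real.log_le_log (by positivity) h1
      _ = 2 * 𝓛 := by rw [Real.log_pow, h𝓛def]; ring
  have hpk : ∀ s : ℂ, 1 - 2 * η ≤ s.re → |s.im| ≤ (D : ℝ) + 1 → s ≠ (ρ : ℂ) →
      χ.LFunction s ≠ 0 ∧ ‖(χ.LFunction s)⁻¹‖ ≤ 3 * Cinv * 𝓛 * (1 + ‖s - ρ‖⁻¹) := by
    intro s hs him hne
    have hls : Real.log (|s.im| + 4) ≤ 2 * 𝓛 :=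
      (Real.log_le_log (by positivity) (by linarith)).trans hlog5
    have hl0 : 0 ≤ Real.log (|s.im| + 4) := Real.log_nonneg (by linarith [abs_nonneg s.im])
    have hsum0 : 0 < Real.log D + Real.log (|s.im| + 4) := by rw [← h𝓛def]; linarith
    have hre : 1 - c / (Real.log D + Real.log (|s.im| + 4)) ≤ s.re := by
      have h1 : 2 * η ≤ c / (Real.log D + Real.log (|s.im| + 4)) := by
        rw [hηdef, le_div_iff₀ hsum0, ← h𝓛def]
        have : 2 * (c / (8 * 𝓛)) * (𝓛 + Real.log (|s.im| + 4)) ≤ 2 * (c / (8 * 𝓛)) * (3 * 𝓛) := by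
          gcongr; linarith
        have e : 2 * (c / (8 * 𝓛)) * (3 * 𝓛) = 3 * c / 4 := by field_simp; ring
        linarith
      linarith
    obtain ⟨hne0, hb⟩ := hzfp s hre hne
    refine ⟨hne0, hb.trans ?_⟩
    have : Cinv * (Real.log D + Real.log (|s.im| + 4)) ≤ 3 * Cinv * 𝓛 := by
      rw [← h𝓛def]
      calc Cinv * (𝓛 + Real.log (|s.im| + 4)) ≤ Cinv * (𝓛 + 2 * 𝓛) := by gcongr
        _ = 3 * Cinv * 𝓛 := by ring
    exact mul_le_mul_of_nonneg_right this (by positivity)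
  -- the continuation `U` of Lemma 8.3 (relative form)
  obtain ⟨U, hUd, hU1, hU2, hU3⟩ := h83 D χ hD83 hq hp hA j hj d r hd hr hdr
  have hd0 : d ≠ 0 := by omega
  have hr0 : r ≠ 0 := by omega
  have hdr0 : d * r ≠ 0 := mul_ne_zero hd0 hr0
  -- `U` on `Re w ≥ 1 − η`: `‖U‖ ≤ C·𝔐 ≤ A₁𝓛^m`
  set MU : ℝ := C * Real.exp (2 * C * (Real.log (2 * Real.log D) + 4) +
    4 * C * Real.log D ^ 9 / (D : ℝ) ^ 2) with hMUdef
  have hMU0 : 0 ≤ MU := by positivity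
  have hlogdr : Real.log ((d * r : ℕ) : ℝ) ≤ Real.log D ^ 9 := by
    have hT2 : 1 ≤ bigT D ^ 2 := one_le_pow₀ (by rw [bigT]; exact Real.one_le_exp_iff.2 (by positivity))
    have h1 : ((d * r : ℕ) : ℝ) ≤ bigP D := by
      refine hdr.le.trans (div_le_self (bigP_pos D).le hT2)
    have h2 : (0 : ℝ) < ((d * r : ℕ) : ℝ) := by exact_mod_cast Nat.pos_of_ne_zero hdr0
    calc Real.log ((d * r : ℕ) : ℝ) ≤ Real.log (bigP D) := Real.log_le_log h2 h1
      _ = Real.log D ^ 9 := by rw [bigP, Real.log_exp, ell]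
  have hU : ∀ w : ℂ, 1 - η ≤ w.re → ‖U w‖ ≤ MU := by
    intro w hw
    have hw9 : 9 / 10 < w.re := by linarith
    have h1 := hU2 w hw9
    have hηL : 2 * η * Real.log D ≤ 1 / 4 := by
      have e : 2 * (c / (8 * 𝓛)) * 𝓛 = c / 4 := by field_simp; ring
      rw [hηdef, ← h𝓛def, e]
      linarith
    have hprod := Lemma84.prod_primeFactors_le (D := D) (n := d * r) (by rw [← h𝓛def]; linarith)
      hdr0 hlogdr hC0 hη0.le hηL (σ := w.re) hw
    calc ‖U w‖ ≤ C₈₃ * ∏ q ∈ (d * r).primeFactors, (1 + C₈₃ * (q : ℝ) ^ (-w.re)) := h1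
      _ ≤ |C₈₃ * ∏ q ∈ (d * r).primeFactors, (1 + C₈₃ * (q : ℝ) ^ (-w.re))| := le_abs_self _
      _ = C * ∏ q ∈ (d * r).primeFactors, |1 + C₈₃ * (q : ℝ) ^ (-w.re)| := by
          rw [abs_mul, Finset.abs_prod]
      _ ≤ C * ∏ q ∈ (d * r).primeFactors, (1 + C * (q : ℝ) ^ (-w.re)) := by
          refine mul_le_mul_of_nonneg_left ?_ hC0
          refine Finset.prod_le_prod (fun _ _ => abs_nonneg _) fun q _ => ?_
          calc |1 + C₈₃ * (q : ℝ) ^ (-w.re)| ≤ |(1 : ℝ)| + |C₈₃ * (q : ℝ) ^ (-w.re)| := abs_add_le _ _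
            _ = 1 + C * (q : ℝ) ^ (-w.re) := by
                rw [abs_one, abs_mul, abs_of_nonneg (Real.rpow_nonneg (Nat.cast_nonneg q) _)]
      _ ≤ MU := mul_le_mul_of_nonneg_left hprod hC0
  have hMUle : MU ≤ A₁ * 𝓛 ^ m := by
    have h := Lemma84.frakM_le (D := D) hC0 (by rw [← h𝓛def]; exact h𝓛1)
    rw [hMUdef, hA₁, h𝓛def]
    calc C * Real.exp (2 * C * (Real.log (2 * Real.log D) + 4) + 4 * C * Real.log D ^ 9 / (D : ℝ) ^ 2)
        ≤ C * (Real.exp (8 * C + 4 * C * ((Nat.factorial 9 : ℝ) / 2 ^ 9)) * 2 ^ ⌈2 * C⌉₊ *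
            Real.log D ^ ⌈2 * C⌉₊) := mul_le_mul_of_nonneg_left h hC0
      _ = _ := by rw [hm]; ring
  -- `U − Π` in the relative form with `C = |C₈₃|`
  have hU3' : ∀ s : ℂ, ‖s - 1‖ ≤ 5 * alpha D → ‖U s - PiW χ d r‖ ≤
      C * (ell D ^ 8)⁻¹ * ∏ q ∈ (d * r).primeFactors, (1 - (q : ℝ)⁻¹)⁻¹ := by
    intro s hs
    refine (hU3 s hs).trans ?_
    have := Literature.NumberTheory.Sieve.GreenTao2008.GYCorr.one_le_prod_one_sub_inv_inv (d * r)
    gcongr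
    exact le_abs_self _
  -- `L(s,χ)` on `Re s ≥ 1 − η`, `|s| ≤ D + 4`
  have hBL : ∀ s : ℂ, 1 - η ≤ s.re → ‖s‖ ≤ (D : ℝ) + 4 → ‖χ.LFunction s‖ ≤ 2 * (4 + 3 * 𝓛) := by
    intro s hs hsn
    have hls : Real.log (‖s‖ + 1) ≤ 2 * 𝓛 :=
      (Real.log_le_log (by positivity) (by linarith)).trans hlog5
    have hl0 : 0 ≤ Real.log (‖s‖ + 1) := Real.log_nonneg (by linarith [norm_nonneg s])
    have h := Lemma84.norm_LFunction_le_near_one χ hχ1 (η := η) (by linarith) hs (by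
      rw [← h𝓛def]
      calc η * (𝓛 + Real.log (‖s‖ + 1)) ≤ η * (𝓛 + 2 * 𝓛) := by gcongr
        _ = 3 * c / 8 := by rw [hηdef]; field_simp; ring
        _ ≤ 1 / 8 := by linarith)
    rw [← h𝓛def] at h
    linarith
  -- `|L′(1,χ)| ≥ ℓ₀`
  have hℓ : ℓ₀ ≤ ‖deriv χ.LFunction 1‖ := by
    have h := h57 D χ hp hq.sq_eq_one hL57 hA'
    have hφpos : (0 : ℝ) < Nat.totient D := by exact_mod_cast Nat.totient_pos.mpr (by omega)
    have hφle : (Nat.totient D : ℝ) ≤ D := by exact_mod_cast Nat.totient_le D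
    have hrat : (1 : ℝ) ≤ (D : ℝ) / Nat.totient D := by rw [le_div_iff₀ hφpos]; linarith
    calc ℓ₀ = Real.exp (-1) / 4 * 1 := (mul_one _).symm
      _ ≤ Real.exp (-1) / 4 * ((D : ℝ) / Nat.totient D) := by gcongr
      _ ≤ (deriv χ.LFunction 1).re := h
      _ ≤ ‖deriv χ.LFunction 1‖ := Complex.re_le_norm _
  -- Lemma 5.8's range and the `E ≤ ℓ₀α/4` condition
  have hK₈L : K₈ * π ≤ Real.log D ^ 8 := hLK₈.trans (le_self_pow₀ h𝓛1 (by norm_num))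
  have hE : C₅ / Real.log D ^ 15 ≤ ℓ₀ * alpha D / 4 := by
    rw [← hαdef, hαeq, ← h𝓛def]
    rw [div_le_iff₀ (by positivity)]
    have h1 : 4 * C₅ ≤ ℓ₀ * π * 𝓛 := by rw [div_le_iff₀ (by positivity)] at hLC₅; linarith
    have h2 : 𝓛 ^ 15 = 𝓛 ^ 9 * 𝓛 ^ 6 := by ring
    have h3 : 𝓛 ≤ 𝓛 ^ 6 := le_self_pow₀ h𝓛1 (by norm_num)
    have h4 : ℓ₀ * π * 𝓛 ≤ ℓ₀ * π * 𝓛 ^ 6 := mul_le_mul_of_nonneg_left h3 (by positivity)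
    calc C₅ = 4 * C₅ / 4 := by ring
      _ ≤ ℓ₀ * π * 𝓛 ^ 6 / 4 := by linarith
      _ = ℓ₀ * (π / 𝓛 ^ 9) / 4 * 𝓛 ^ 15 := by rw [h2]; field_simp
  -- sizes of `x` and `log x`
  have hT1 : 1 ≤ bigT D := by
    rw [bigT]; exact Real.one_le_exp (Real.rpow_nonneg (by rw [ell]; exact Real.log_natCast_nonneg D) _)
  have hx1' : 1 ≤ x := le_trans hT1 hx1
  have hx0 : 0 < x := by linarith
  have hLy1 : 𝓛 ^ (1.1 : ℝ) ≤ Real.log x := by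
    have : Real.log (bigT D) ≤ Real.log x := Real.log_le_log (by rw [bigT]; exact Real.exp_pos _) hx1
    rwa [bigT, Real.log_exp] at this
  have hLy2 : Real.log x ≤ 𝓛 ^ 9 := by
    have : Real.log x ≤ Real.log (bigP D) := Real.log_le_log hx0 hx2
    rwa [bigP, Real.log_exp] at this
  -- the core estimate
  have hcore := logMean_core χ c' hχ1 hp h𝓛3 hA' j hd0 hr0 hx1' U (ρ := ρ) (η := η) (MU := MU)
    (BL := 2 * (4 + 3 * 𝓛)) (Minv := 3 * Cinv * 𝓛) (C₈₃ := C) (K := K₈) (ℓ₀ := ℓ₀) hUd hU1 hMU0 hU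
    hC0 hU3' hαη hη40 (by positivity) hBL (by positivity) hpk hρ1 hρη hρα hLρ hL'ρ hℓ₀0 hℓ le_rfl
    hK₈L hE
  refine hcore.trans ?_
  have h := Lemma84.rhs_le (Ly := Real.log x)
    (hatPi := ∏ q ∈ (d * r).primeFactors, (1 - (q : ℝ)⁻¹)⁻¹)
    (α := alpha D) (η := η) (T := (D : ℝ)) (BL := 2 * (4 + 3 * 𝓛)) (Minv := 3 * Cinv * 𝓛)
    h𝓛3 hc hc4 hCinv hC0 hK₈1 hA₁0 hMU0 hMUle
    (Literature.NumberTheory.Sieve.GreenTao2008.GYCorr.one_le_prod_one_sub_inv_inv (d * r)) hLy1 hLy2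
    hαeq rfl hDexp rfl rfl
  rw [hCfin]
  exact h

/-! ### (10.8)–(10.10) in relative form, from Lemma 8.3 (relative form) -/

/-- **(10.8), relative form, from Lemma 8.3 (relative form)**: for `D` large, (A), `1 ≤ j ≤ 3`,
`d, r ≥ 1`, `dr ≤ P^{0.5}/T`: `‖𝔳₂ⱼ(d,r) − (L′(1,χ)Π(d,r)/500)β_{j+1}β_{j+2}log P‖ ≤
C𝓛⁻¹⁵(∏_{q∣dr}(1−q⁻¹)⁻¹)²` — clause 1 of `Skeleton.Lemma102Rel c′` (sz-d43's `eq108Rel_of_logMean`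
fed with LEMMA A). [cite: Zhang2022LandauSiegel, §10 Lemma 10.2 (10.8)] -/
theorem eq108Rel_of_lemma83Rel {c' : ℝ} (h83 : Lemma83Rel c') :
    ∃ C : ℝ, ForAllLarge fun D _ χ => AssumptionA D χ →
      ∀ j ∈ ({1, 2, 3} : Finset ℕ), ∀ d r : ℕ, 1 ≤ d → 1 ≤ r →
        ((d * r : ℕ) : ℝ) ≤ bigP D ^ (0.5 : ℝ) / bigT D →
          ‖frakv2 c' χ j d r - deriv χ.LFunction 1 * PiW χ d r / 500 *
            (betaJ c' D (j + 1) * betaJ c' D (j + 2)) * Real.log (bigP D)‖ ≤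
            C * (ell D ^ 15)⁻¹ * (∏ q ∈ (d * r).primeFactors, (1 - (q : ℝ)⁻¹)⁻¹) ^ 2 :=
  eq108Rel_of_logMean (logMeanRel_of_lemma83Rel h83)

/-- **(10.9), relative form, from Lemma 8.3 (relative form)**: for `P^{0.5} < dr ≤ P^{0.502}/T`,
`‖𝔳₂ⱼ(d,r) − (500L′(1,χ)Π(d,r)/log P)(−1 + 𝔶₁ⱼ(dr))‖ ≤ C𝓛⁻¹⁵(∏_{q∣dr}(1−q⁻¹)⁻¹)²` — clause 2 of
`Skeleton.Lemma102Rel c′`. [cite: Zhang2022LandauSiegel, §10 Lemma 10.2 (10.9)] -/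
theorem eq109Rel_of_lemma83Rel {c' : ℝ} (h83 : Lemma83Rel c') :
    ∃ C : ℝ, ForAllLarge fun D _ χ => AssumptionA D χ →
      ∀ j ∈ ({1, 2, 3} : Finset ℕ), ∀ d r : ℕ, 1 ≤ d → 1 ≤ r →
        bigP D ^ (0.5 : ℝ) < ((d * r : ℕ) : ℝ) → ((d * r : ℕ) : ℝ) ≤ bigP D ^ (0.502 : ℝ) / bigT D →
          ‖frakv2 c' χ j d r - 500 * deriv χ.LFunction 1 * PiW χ d r / Real.log (bigP D) *
            (-1 + fraky1 c' D j ((d * r : ℕ) : ℝ))‖ ≤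
            C * (ell D ^ 15)⁻¹ * (∏ q ∈ (d * r).primeFactors, (1 - (q : ℝ)⁻¹)⁻¹) ^ 2 :=
  eq109Rel_of_logMean (logMeanRel_of_lemma83Rel h83)

/-- **(10.10), relative form, from Lemma 8.3 (relative form)**: for `P^{0.502} < dr ≤ P^{0.504}/T`,
`‖𝔳₂ⱼ(d,r) − (500L′(1,χ)Π(d,r)/log P)(1 + 𝔶₂ⱼ(dr))‖ ≤ C𝓛⁻¹⁵(∏_{q∣dr}(1−q⁻¹)⁻¹)²` — clause 3 of
`Skeleton.Lemma102Rel c′`. [cite: Zhang2022LandauSiegel, §10 Lemma 10.2 (10.10)] -/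
theorem eq1010Rel_of_lemma83Rel {c' : ℝ} (h83 : Lemma83Rel c') :
    ∃ C : ℝ, ForAllLarge fun D _ χ => AssumptionA D χ →
      ∀ j ∈ ({1, 2, 3} : Finset ℕ), ∀ d r : ℕ, 1 ≤ d → 1 ≤ r →
        bigP D ^ (0.502 : ℝ) < ((d * r : ℕ) : ℝ) →
          ((d * r : ℕ) : ℝ) ≤ bigP D ^ (0.504 : ℝ) / bigT D →
          ‖frakv2 c' χ j d r - 500 * deriv χ.LFunction 1 * PiW χ d r / Real.log (bigP D) *
            (1 + fraky2 c' D j ((d * r : ℕ) : ℝ))‖ ≤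
            C * (ell D ^ 15)⁻¹ * (∏ q ∈ (d * r).primeFactors, (1 - (q : ℝ)⁻¹)⁻¹) ^ 2 :=
  eq1010Rel_of_logMean (logMeanRel_of_lemma83Rel h83)

end Literature.NumberTheory.LFunctions.Zhang2022.Lemma102
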